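import Summits.CriticalPhenomena.SAWScalingLimit.Theses.SAWReversalUpgrade
import Literature.Probability.RandomPlanarGeometry.DrivingConvergenceEngine
import Literature.Probability.Process.PathSpaceCoupling
import Literature.Probability.RandomPlanarGeometry.SLETraceEightAssembly
import HarnessLib

/-!
# Stub `stub_lawOfCoupling` of line `lsw-engine` for the crux `ForwardDriving`
(stmt-CriticalPhenomena-18003, route SAWReversalUpgrade)

S3 (L): couplings uniformly close on `[0, T]` ⇒ convergence in law of the restricted driving
functions to `√(8/3) B` restricted to `[0, T]` (Billingsley Thm 3.1 in coupling form + Brownian scaling).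

Pure measure theory, no SAW content. The proof:

* `wienerLawC_map_timeScale_eightThirds` — Brownian scaling on path space: the law of
  `t ↦ B(8t/3)` (`wienerLawC.map (timeScale (8/3))`) is the law of the SLE_{8/3} driving path
  `√(8/3) B` (`preWienerMeasure.map (drivingPath (8/3))`), by the tree's
  `map_timeScaledPath_eq_map_drivingPath`;
* `tendsto_integral_restrict_of_coupling_nat` — along a sequence of probability laws `μₙ` on
  `C([0, ∞), ℝ)` coupled to a fixed `ν` with `ρ[∃ t ≤ T, ε < dist] < η` eventually, the integrals
  of `g (p|[0, T])` converge for every bounded continuous `g` on `C([0, T], ℝ)`: stop the paths at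
  `T` (a continuous self-map of path space that does not change the restriction to `[0, T]` and
  turns closeness on `[0, T]` into closeness on every horizon) and apply the tree's closed-set
  portmanteau argument `Process.tendstoInDistribution_of_coupling` (Billingsley Thm 3.1);
* `tendsto_integral_restrict_of_coupling` — the same along the mesh filter `𝓝[>] 0`, for laws
  `(P δ).map (W δ)` that are only eventually probability measures (sequences,
  `Filter.tendsto_iff_seq_tendsto`, and a shift of the index).
-/

noncomputable section

namespace Summit.CriticalPhenomena.SAWScalingLimit.Cruxes.ForwardDriving.LswEngine

open scoped BigOperators Topology Classical MeasureTheory ProbabilityTheory NNReal ENNReal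
open scoped Literature.Probability.RandomPlanarGeometry.PathBorel BoundedContinuousFunction
open Filter Set Function TopologicalSpace MeasureTheory
open Literature.Probability Literature.Probability.RandomPlanarGeometry

/-! ### Brownian scaling: the law of `t ↦ B(8t/3)` is the law of `√(8/3) B` -/

/-- **Brownian scaling on path space, `κ = 8/3`**: the image of the Wiener law on `C([0, ∞), ℝ)`
under the time change `t ↦ 8t/3` is the law of the SLE_{8/3} driving path `√(8/3) B` of the
canonical Brownian motion (`map_timeScaledPath_eq_map_drivingPath` for the canonical Brownian
path; the `κ = 8` case is `USTPeano.map_brownianTimeEight_eq`). Rohde–Schramm (2005), §2.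
[folklore] -/
theorem wienerLawC_map_timeScale_eightThirds :
    wienerLawC.map (SkorokhodEmbedding.timeScale ((8:ℝ≥0)/3)) =
      Process.preWienerMeasure.map (drivingPath ((8:ℝ≥0)/3)) := by
  have h : SkorokhodEmbedding.timeScale ((8:ℝ≥0)/3) ∘ brownianPathC = fun ω ↦
      (⟨fun t ↦ Process.brownian ((8:ℝ≥0)/3 * t) ω,
        (Process.continuous_brownian ω).comp (continuous_const.mul continuous_id)⟩ :
        C(ℝ≥0, ℝ)) := by
    funext ω
    ext t
    rfl
  rw [wienerLawC, Measure.map_map (SkorokhodEmbedding.measurable_timeScale _)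
    measurable_brownianPathC, h]
  exact map_timeScaledPath_eq_map_drivingPath (κ := (8:ℝ≥0)/3)
    (div_ne_zero (by norm_num) (by norm_num))
    (Process.isBrownianReal_brownian exists_isBrownianReal_measurable_continuous_holds')
    Process.continuous_brownian Process.measurable_brownian

/-! ### Billingsley's Theorem 3.1 in coupling form, restricted to `[0, T]` -/

/-- **Couplings uniformly close on `[0, T]` give convergence of the laws restricted to `[0, T]`**
(sequence version). If `μₙ, ν` are probability measures on `C([0, ∞), ℝ)` and for all
`ε, η > 0`, eventually in `n`, there is a coupling `ρ` of `μₙ` and `ν` with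
`ρ[∃ t ≤ T, ε < |p₁(t) - p₂(t)|] < η`, then `∫ g (p|[0, T]) dμₙ → ∫ g (p|[0, T]) dν` for every
bounded continuous `g` on `C([0, T], ℝ)`. Proof: the stopping map `S p = p(· ∧ T)` is continuous,
`(S p)|[0, T] = p|[0, T]`, and the pushed-forward couplings of the laws of the stopped paths are
close on every horizon, so `Process.tendstoInDistribution_of_coupling` (closed-set portmanteau)
applies; then test against `g ∘ (·)|[0, T]`. Billingsley (1999), Thm. 3.1.
[cite: Billingsley1999, Thm. 3.1] -/
theorem tendsto_integral_restrict_of_coupling_nat {μ : ℕ → Measure C(ℝ≥0, ℝ)}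
    [∀ n, IsProbabilityMeasure (μ n)] {ν : Measure C(ℝ≥0, ℝ)} [IsProbabilityMeasure ν]
    {T : ℝ≥0}
    (hcoup : ∀ ε η : ℝ, 0 < ε → 0 < η → ∀ᶠ n in atTop,
      ∃ ρ : Measure (C(ℝ≥0, ℝ) × C(ℝ≥0, ℝ)), ρ.fst = μ n ∧ ρ.snd = ν ∧
        ρ {p | ∃ t : ℝ≥0, (t : ℝ) ≤ (T : ℝ) ∧ ε < dist (p.1 t) (p.2 t)} < ENNReal.ofReal η)
    (g : C(Set.Icc (0 : ℝ≥0) T, ℝ) →ᵇ ℝ) :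
    Tendsto (fun n ↦ ∫ p, g (p.restrict (Set.Icc 0 T)) ∂μ n) atTop
      (𝓝 (∫ p, g (p.restrict (Set.Icc 0 T)) ∂ν)) := by
  -- the stopping map `S p = p (· ∧ T)`
  obtain ⟨S, hS_apply, hSc⟩ : ∃ S : C(ℝ≥0, ℝ) → C(ℝ≥0, ℝ),
      (∀ (p : C(ℝ≥0, ℝ)) (t : ℝ≥0), S p t = p (min t T)) ∧ Continuous S :=
    ⟨fun p ↦ p.comp ⟨fun t ↦ min t T, continuous_id.min continuous_const⟩, fun _ _ ↦ rfl,
      ContinuousMap.continuous_precomp _⟩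
  have hSm : Measurable S := hSc.measurable
  have hS_restrict : ∀ p : C(ℝ≥0, ℝ),
      (S p).restrict (Set.Icc 0 T) = p.restrict (Set.Icc 0 T) := by
    intro p
    ext x
    rw [ContinuousMap.restrict_apply, ContinuousMap.restrict_apply, hS_apply, min_eq_left x.2.2]
  -- the stopped paths converge in distribution on `C([0, ∞), ℝ)`
  have hlaw : TendstoInDistribution (fun _ : ℕ ↦ S) atTop S μ ν := by
    refine Process.tendstoInDistribution_of_coupling (fun _ ↦ hSm.aemeasurable) hSm.aemeasurable
      fun T' ε hε η hη ↦ ?_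
    -- push the couplings forward along `S × S`
    have hS1 : Measurable fun p : C(ℝ≥0, ℝ) × C(ℝ≥0, ℝ) ↦ S p.1 := hSm.comp measurable_fst
    have hS2 : Measurable fun p : C(ℝ≥0, ℝ) × C(ℝ≥0, ℝ) ↦ S p.2 := hSm.comp measurable_snd
    have hSS : Measurable fun p : C(ℝ≥0, ℝ) × C(ℝ≥0, ℝ) ↦ (S p.1, S p.2) := hS1.prodMk hS2
    have main : ∀ η' : ℝ, 0 < η' → ∀ᶠ n in atTop, ∃ ρ : Measure (C(ℝ≥0, ℝ) × C(ℝ≥0, ℝ)),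
        ρ.fst = (μ n).map S ∧ ρ.snd = ν.map S ∧
          ρ {p | ∃ t : ℝ≥0, (t : ℝ) ≤ T' ∧ ε ≤ dist (p.1 t) (p.2 t)} ≤ ENNReal.ofReal η' := by
      intro η' hη'
      filter_upwards [hcoup (ε / 2) η' (half_pos hε) hη'] with n ⟨ρ, h1, h2, h3⟩
      refine ⟨ρ.map fun p ↦ (S p.1, S p.2), ?_, ?_, ?_⟩
      · rw [Measure.fst_map_prodMk hS2, ← h1, Measure.fst, Measure.map_map hSm measurable_fst]
        rfl
      · rw [Measure.snd_map_prodMk hS1, ← h2, Measure.snd, Measure.map_map hSm measurable_snd]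
        rfl
      · have hclosed : IsClosed {p : C(ℝ≥0, ℝ) × C(ℝ≥0, ℝ) |
            ∃ t : ℝ≥0, (t : ℝ) ≤ T' ∧ ε ≤ dist (p.1 t) (p.2 t)} :=
          SkorokhodEmbedding.isClosed_supDevSet T' ε
        rw [Measure.map_apply hSS hclosed.measurableSet]
        refine (measure_mono ?_).trans h3.le
        intro p hp
        obtain ⟨t, -, ht⟩ : ∃ t : ℝ≥0, (t : ℝ) ≤ T' ∧ ε ≤ dist (S p.1 t) (S p.2 t) := hp
        rw [hS_apply, hS_apply] at ht
        exact ⟨min t T, NNReal.coe_le_coe.2 (min_le_right t T), (half_lt_self hε).trans_le ht⟩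
    rcases eq_or_ne η ⊤ with rfl | hηtop
    · filter_upwards [main 1 one_pos] with n ⟨ρ, h1, h2, _⟩
      exact ⟨ρ, h1, h2, le_top⟩
    · filter_upwards [main η.toReal (ENNReal.toReal_pos hη.ne' hηtop)] with n ⟨ρ, h1, h2, h3⟩
      exact ⟨ρ, h1, h2, h3.trans ENNReal.ofReal_toReal_le⟩
  -- portmanteau, tested against `g ∘ (·)|[0, T]`
  obtain ⟨G, hG⟩ : ∃ G : C(ℝ≥0, ℝ) →ᵇ ℝ, ∀ p, G p = g (p.restrict (Set.Icc 0 T)) :=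
    ⟨g.compContinuous ⟨fun p ↦ p.restrict (Set.Icc 0 T), ContinuousMap.continuous_restrict _⟩,
      fun _ ↦ rfl⟩
  have hGS : ∀ p, G (S p) = g (p.restrict (Set.Icc 0 T)) := fun p ↦ by rw [hG, hS_restrict]
  have h1 : ∀ n, ∫ x, G x ∂((μ n).map S) = ∫ p, g (p.restrict (Set.Icc 0 T)) ∂μ n := fun n ↦ by
    rw [integral_map hSm.aemeasurable G.continuous.aestronglyMeasurable]
    simp only [hGS]
  have h2 : ∫ x, G x ∂(ν.map S) = ∫ p, g (p.restrict (Set.Icc 0 T)) ∂ν := by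
    rw [integral_map hSm.aemeasurable G.continuous.aestronglyMeasurable]
    simp only [hGS]
  have key := hlaw.tendsto
  rw [ProbabilityMeasure.tendsto_iff_forall_integral_tendsto] at key
  have key' := key G
  simp only [ProbabilityMeasure.coe_mk, h1, h2] at key'
  exact key'

/-- **Couplings uniformly close on `[0, T]` give convergence of the laws restricted to `[0, T]`**,
along the mesh filter `δ → 0⁺`: if the laws `(P δ).map (W δ)` of measurable random paths `W δ`
admit, for all `ε, η > 0` and all small `δ > 0`, a probability coupling `ρ` with a fixed
probability law `ν` on `C([0, ∞), ℝ)` charging `{∃ t ≤ T, ε < |p₁(t) - p₂(t)|}` by `< η`, then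
`∫ g ((W δ ω)|[0, T]) dP δ → ∫ g (p|[0, T]) dν` for every bounded continuous `g` on
`C([0, T], ℝ)`. Reduction to `tendsto_integral_restrict_of_coupling_nat` along sequences
(`𝓝[>] 0` is countably generated); the laws are probability measures for all small `δ` (first
marginal of a probability coupling), so a shift of the index makes them all probability
measures. Billingsley (1999), Thm. 3.1. [cite: Billingsley1999, Thm. 3.1] -/
theorem tendsto_integral_restrict_of_coupling {Ωδ : ℝ → Type*} [∀ δ, MeasurableSpace (Ωδ δ)]
    (P : ∀ δ, Measure (Ωδ δ)) (W : ∀ δ, Ωδ δ → C(ℝ≥0, ℝ)) (hW : ∀ δ, Measurable (W δ))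
    (ν : Measure C(ℝ≥0, ℝ)) [IsProbabilityMeasure ν] (T : ℝ≥0)
    (hcoup : ∀ ε η : ℝ, 0 < ε → 0 < η → ∀ᶠ δ in 𝓝[>] (0 : ℝ),
      ∃ ρ : Measure (C(ℝ≥0, ℝ) × C(ℝ≥0, ℝ)), IsProbabilityMeasure ρ ∧
        ρ.fst = (P δ).map (W δ) ∧ ρ.snd = ν ∧
        ρ {p | ∃ t : ℝ≥0, (t : ℝ) ≤ (T : ℝ) ∧ ε < dist (p.1 t) (p.2 t)} < ENNReal.ofReal η)
    (g : C(Set.Icc (0 : ℝ≥0) T, ℝ) →ᵇ ℝ) :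
    Tendsto (fun δ ↦ ∫ ω, g ((W δ ω).restrict (Set.Icc 0 T)) ∂P δ) (𝓝[>] (0 : ℝ))
      (𝓝 (∫ p, g (p.restrict (Set.Icc 0 T)) ∂ν)) := by
  rw [tendsto_iff_seq_tendsto]
  intro u hu
  -- for all large `n` the law is a probability measure
  have hprob : ∀ᶠ n in atTop, IsProbabilityMeasure ((P (u n)).map (W (u n))) := by
    filter_upwards [hu.eventually (hcoup 1 1 one_pos one_pos)] with n hn
    obtain ⟨ρ, hρ, h1, -, -⟩ := hn
    rw [← h1]
    infer_instance
  obtain ⟨N, hN⟩ := eventually_atTop.1 hprob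
  rw [← tendsto_add_atTop_iff_nat N]
  haveI : ∀ k, IsProbabilityMeasure ((P (u (k + N))).map (W (u (k + N)))) :=
    fun k ↦ hN _ (Nat.le_add_left N k)
  have hv : Tendsto (fun k ↦ u (k + N)) atTop (𝓝[>] (0 : ℝ)) :=
    hu.comp (tendsto_add_atTop_nat N)
  have key := tendsto_integral_restrict_of_coupling_nat
    (μ := fun k ↦ (P (u (k + N))).map (W (u (k + N)))) (ν := ν) (T := T)
    (fun ε η hε hη ↦ by
      filter_upwards [hv.eventually (hcoup ε η hε hη)] with k hk
      obtain ⟨ρ, -, h1, h2, h3⟩ := hk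
      exact ⟨ρ, h1, h2, h3⟩) g
  have hF : Continuous fun p : C(ℝ≥0, ℝ) ↦ g (p.restrict (Set.Icc 0 T)) :=
    g.continuous.comp (ContinuousMap.continuous_restrict _)
  refine Tendsto.congr (fun k ↦ ?_) key
  simp only [Function.comp_apply]
  exact integral_map (hW _).aemeasurable hF.aestronglyMeasurable

/-- S3 (L): from couplings to convergence in law of the restricted driving functions (Slutsky on
`C(Icc 0 T, ℝ)` against the fixed scaled Wiener law, then Brownian scaling `B(8t/3) =ᵈ √(8/3) B_t =
sleDriving (8/3)`). [cite: LawlerSchrammWerner2004, Theorem 3.7] -/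
theorem stub_lawOfCoupling :
    ∀ (D : Literature.Probability.RandomPlanarGeometry.DobrushinDomain) (a b : ℝ → Literature.Probability.LatticeModels.Site 2) (φ : Literature.Probability.RandomPlanarGeometry.ConformalEquiv UpperHalfPlane.upperHalfPlaneSet D.carrier) (att : ((δ : ℝ) → Literature.Probability.RandomPlanarGeometry.SAW.DomainSAW (D).carrier δ (a δ) (b δ) → Literature.Probability.RandomPlanarGeometry.Curve ℂ)) (T : NNReal), (∀ ε₂ ε₃ : ℝ, 0 < ε₂ → 0 < ε₃ → ∀ᶠ δ in nhdsWithin 0 (Set.Ioi 0), ∃ ρ : MeasureTheory.Measure (C(NNReal, ℝ) × C(NNReal, ℝ)), MeasureTheory.IsProbabilityMeasure ρ ∧ ρ.fst = (Literature.Probability.RandomPlanarGeometry.SAW.law D.carrier δ (a δ) (b δ)).map (fun γ => (⟨Literature.Probability.RandomPlanarGeometry.drivingFunction φ (Literature.Probability.RandomPlanarGeometry.CurveClass.mk (att δ γ)), Literature.Probability.RandomPlanarGeometry.continuous_drivingFunction φ (Literature.Probability.RandomPlanarGeometry.CurveClass.mk (att δ γ))⟩ : C(NNReal, ℝ))) ∧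 ρ.snd = Literature.Probability.RandomPlanarGeometry.wienerLawC.map (Literature.Probability.RandomPlanarGeometry.SkorokhodEmbedding.timeScale ((8:NNReal)/3)) ∧ ρ {p | ∃ t : NNReal, (t : ℝ) ≤ (T : ℝ) ∧ ε₂ < dist (p.1 t) (p.2 t)} < ENNReal.ofReal ε₃) → Literature.Probability.RandomPlanarGeometry.TendstoLaw (fun δ (γ : Literature.Probability.RandomPlanarGeometry.SAW.DomainSAW D.carrier δ (a δ) (b δ)) => ((⟨Literature.Probability.RandomPlanarGeometry.drivingFunction (φ) (Literature.Probability.RandomPlanarGeometry.CurveClass.mk (att δ γ)), Literature.Probability.RandomPlanarGeometry.continuous_drivingFunction (φ) (Literature.Probability.RandomPlanarGeometry.CurveClass.mk (att δ γ))⟩ : C(NNReal, ℝ)).restrict (Set.Icc (0:NNReal) T))) (fun δ => Literature.Probability.RandomPlanarGeometry.SAW.law (D).carrier δ (a δ) (b δ)) (fun ω : NNReal → ℝ => ((⟨Literature.Probability.RandomPlanarGeometry.sleDriving ((8:NNReal)/3) ω, Literature.Probability.RandomPlanarGeometry.continuous_sleDriving ((8:NNReal)/3) ω⟩ : C(NNReal,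 ℝ)).restrict (Set.Icc (0:NNReal) T))) Literature.Probability.Process.preWienerMeasure := by
  intro D a b φ att T hcoup f
  haveI : IsProbabilityMeasure
      (wienerLawC.map (SkorokhodEmbedding.timeScale ((8:ℝ≥0)/3)) : Measure C(ℝ≥0, ℝ)) :=
    Measure.isProbabilityMeasure_map (SkorokhodEmbedding.measurable_timeScale _).aemeasurable
  -- Billingsley Thm 3.1 in coupling form against the fixed law of `t ↦ B(8t/3)`
  have key := tendsto_integral_restrict_of_coupling
    (fun δ ↦ SAW.law D.carrier δ (a δ) (b δ))
    (fun δ γ ↦ (⟨drivingFunction φ (CurveClass.mk (att δ γ)),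
      continuous_drivingFunction φ (CurveClass.mk (att δ γ))⟩ : C(ℝ≥0, ℝ)))
    (fun δ ↦ SAW.DomainSAW.measurable_of_top _)
    (wienerLawC.map (SkorokhodEmbedding.timeScale ((8:ℝ≥0)/3))) T hcoup f
  -- Brownian scaling: the limit law is the law of `√(8/3) B = sleDriving (8/3)`
  have hF : Continuous fun p : C(ℝ≥0, ℝ) ↦ f (p.restrict (Set.Icc 0 T)) :=
    f.continuous.comp (ContinuousMap.continuous_restrict _)
  rw [wienerLawC_map_timeScale_eightThirds,
    integral_map (measurable_drivingPath _).aemeasurable hF.aestronglyMeasurable] at key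
  exact key

end Summit.CriticalPhenomena.SAWScalingLimit.Cruxes.ForwardDriving.LswEngine

end
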